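import Mathlib
import HarnessLib
import Summits.FinalStateConjecture.Statement
import Literature.Geometry.Lorentzian.LandauLifshitzPseudotensor

/-!
# Route EIHFluxBalance — `InertialRecession`, line `sublinear-is-free-clean-window-charges`:
# unpacking the `ℝ≥0∞`-valued decay clauses into pointwise real bounds (helpers for `stub_chargeModel`)

Helper file (`--supports stmt-FinalStateConjecture-10166`) for the crux
`Summit.FinalStateConjecture.FinalStateConjecture.Theses.EIHFluxBalance.InertialRecession`.

The crux antecedent and the stubs of the line state decay as `Tendsto (t ↦ ⨆ …, ENNReal.ofReal w * ‖·‖ₑ)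
atTop (𝓝 0)` over slabs of the lab chart. Every consumer (window law, identification, quasi-stationarity,
re-charting) needs them as: "for every `ε > 0`, eventually in `t`, at every point of the slab,
`w · ‖D^m f‖ ≤ ε`". This file does that bookkeeping once:

* `mul_norm_le_of_le_ofReal` — `ofReal w * ‖a‖ₑ ≤ ofReal ε ⇒ w‖a‖ ≤ ε`;
* `weightedClause_pointwise` — the crux's weighted clause (weight `1 + d^{7/4}`, `m ≤ 3`, cone
  `‖x~‖ ≤ κt`) pointwise;
* `quasiStationarity_pointwise` — the quasi-stationarity clause of `stub_quasiStationarity` pointwise;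
* `deviationCk_pointwise` — `deviationCk B Φ k t → 0` pointwise on the slabs `{time = t}`;
* `sqrt_sqrt_pow_seven` — the weight is `d^{7/4}`: `√(√(d⁷)) = d ^ (7/4 : ℝ)` for `d ≥ 0`;
* `le_iInf_norm_sub_iff`, `iInf_norm_sub_le` — the distance to the nearest centre `⨅ i, ‖y − ξᵢ‖` over
  `Fin N`, `0 < N`;
* `clearance_of_window`, `clearance_of_mem_ball` — on a `δ`-admissible window sphere `|y − c| = R`
  (every centre within `(1−δ)R` or beyond `(1+δ)R` of `c`) every point is at distance `≥ δR` from every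
  centre; points of the ball are at distance `≥ δR` from every outsider.
-/

set_option linter.dupNamespace false
-- instance search on the nested operator spaces needs a deeper pending depth (as in `CoordCurvature.lean`)
set_option maxSynthPendingDepth 3

noncomputable section

open scoped ENNReal Topology Manifold ContDiff
open Filter Set TopologicalSpace Literature.Geometry.Lorentzian

namespace Summit.FinalStateConjecture.FinalStateConjecture.Theorems

namespace WindowBounds

/-! ### From `ℝ≥0∞` bounds to real bounds -/

/-- `ofReal w * ‖a‖ₑ ≤ ofReal ε` with `0 ≤ w`, `0 ≤ ε` gives `w * ‖a‖ ≤ ε`. [folklore] -/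
theorem mul_norm_le_of_le_ofReal {F : Type*} [NormedAddCommGroup F] {w ε : ℝ} {a : F}
    (hw : 0 ≤ w) (hε : 0 ≤ ε) (h : ENNReal.ofReal w * ‖a‖ₑ ≤ ENNReal.ofReal ε) : w * ‖a‖ ≤ ε := by
  rw [← ofReal_norm, ← ENNReal.ofReal_mul hw] at h
  exact (ENNReal.ofReal_le_ofReal_iff hε).1 h

/-- A function tending to `0` in `ℝ≥0∞` is eventually below `ofReal ε`, `ε > 0`. [folklore] -/
theorem eventually_le_ofReal_of_tendsto_zero {F : ℝ → ℝ≥0∞} (h : Tendsto F atTop (𝓝 0)) {ε : ℝ}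
    (hε : 0 < ε) : ∀ᶠ t in atTop, F t ≤ ENNReal.ofReal ε :=
  (ENNReal.tendsto_nhds_zero.1 h) (ENNReal.ofReal ε) (ENNReal.ofReal_pos.2 hε)

/-! ### The weighted clause of the crux antecedent -/

/-- **The weighted decay clause, pointwise.** If
`⨆_{x ∈ U, x⁰ = t, ‖x~‖ ≤ κt} ⨆_{m ≤ 3} (1 + d(x)^{7/4}) ‖D^m h(x)‖ → 0` (`d(x) = ⨅ᵢ ‖x~ − ξᵢ(t)‖`, the
crux's weight written `1 + √(√(d⁷))`), then for every `ε > 0`, eventually in `t`, at every such point and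
every `m ≤ 3`, `(1 + d(x)^{7/4}) ‖D^m h(x)‖ ≤ ε`. [folklore] -/
theorem weightedClause_pointwise {N : ℕ} {U : Opens E4} {κ : ℝ} {ξ : Fin N → ℝ → E3}
    {h : E4 → E4 →L[ℝ] E4 →L[ℝ] ℝ}
    (hW : Tendsto (fun t : ℝ ↦ ⨆ x ∈ {x : U | x.1 0 = t ∧ E4.spatialNorm x.1 ≤ κ * t},
      ⨆ (m : ℕ) (_ : m ≤ 3), ENNReal.ofReal (1 + √(√((⨅ i, ‖E4.spatial x.1 - ξ i t‖) ^ 7))) *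
        ‖iteratedFDeriv ℝ m h x.1‖ₑ) atTop (𝓝 0))
    {ε : ℝ} (hε : 0 < ε) :
    ∀ᶠ t in atTop, ∀ x : E4, x ∈ (U : Set E4) → x 0 = t → E4.spatialNorm x ≤ κ * t →
      ∀ m : ℕ, m ≤ 3 →
        (1 + √(√((⨅ i, ‖E4.spatial x - ξ i t‖) ^ 7))) * ‖iteratedFDeriv ℝ m h x‖ ≤ ε := by
  filter_upwards [eventually_le_ofReal_of_tendsto_zero hW hε] with t ht
  intro x hxU hx0 hxκ m hm
  refine mul_norm_le_of_le_ofReal (a := iteratedFDeriv ℝ m h x) (by positivity) hε.le (le_trans ?_ ht)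
  exact le_iSup₂_of_le (⟨x, hxU⟩ : U) ⟨hx0, hxκ⟩ (le_iSup₂_of_le m hm le_rfl)

/-! ### The quasi-stationarity clause -/

/-- **The quasi-stationarity clause, pointwise.** If
`⨆_{x⁰ = t, ‖x~‖ ≤ κt, ρ(t) ≤ d(x)} (1 + d(x)^{7/4}) ‖∂₀ G(x)‖ → 0`, then for every `ε > 0`, eventually
in `t`, at every such point `(1 + d(x)^{7/4}) ‖DG(x) e₀‖ ≤ ε`. [folklore] -/
theorem quasiStationarity_pointwise {N : ℕ} {κ : ℝ} {ξ : Fin N → ℝ → E3} {ρ : ℝ → ℝ}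
    {G : E4 → E4 →L[ℝ] E4 →L[ℝ] ℝ}
    (hQ : Tendsto (fun t : ℝ ↦ ⨆ x ∈ {x : E4 | x 0 = t ∧ E4.spatialNorm x ≤ κ * t ∧
      ρ t ≤ ⨅ i, ‖E4.spatial x - ξ i t‖},
        ENNReal.ofReal (1 + √(√((⨅ i, ‖E4.spatial x - ξ i t‖) ^ 7))) *
          ‖fderiv ℝ G x (E4.basisVector 0)‖ₑ) atTop (𝓝 0))
    {ε : ℝ} (hε : 0 < ε) :
    ∀ᶠ t in atTop, ∀ x : E4, x 0 = t → E4.spatialNorm x ≤ κ * t → ρ t ≤ ⨅ i, ‖E4.spatial x - ξ i t‖ →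
      (1 + √(√((⨅ i, ‖E4.spatial x - ξ i t‖) ^ 7))) * ‖fderiv ℝ G x (E4.basisVector 0)‖ ≤ ε := by
  filter_upwards [eventually_le_ofReal_of_tendsto_zero hQ hε] with t ht
  intro x hx0 hxκ hxρ
  refine mul_norm_le_of_le_ofReal (a := fderiv ℝ G x (E4.basisVector 0)) (by positivity) hε.le
    (le_trans ?_ ht)
  exact le_iSup₂_of_le x ⟨hx0, hxκ, hxρ⟩ le_rfl

/-! ### The unweighted `Cᵏ` clause -/

/-- **`deviationCk → 0`, pointwise.** If the `Cᵏ` deviation of the chart `Φ` on the slabs `{time = t}`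
tends to `0`, then for every `ε > 0`, eventually in `t`, `‖D^m (Φ^* g − G)(x)‖ ≤ ε` for every `x ∈ U`
with `time x = t` and every `m ≤ k` (DHRT arXiv:2104.08222, §1, read pointwise). [folklore] -/
theorem deviationCk_pointwise (𝓢 : Spacetime 4) (B : ModelBackground) (Φ : B.domain → 𝓢.carrier)
    {k : ℕ} (hd : Tendsto (fun t ↦ 𝓢.deviationCk B Φ k t) atTop (𝓝 0)) {ε : ℝ} (hε : 0 < ε) :
    ∀ᶠ t in atTop, ∀ x : E4, x ∈ (B.domain : Set E4) → B.time x = t → ∀ m : ℕ, m ≤ k →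
      ‖iteratedFDeriv ℝ m (𝓢.deviationExtend B Φ) x‖ ≤ ε := by
  filter_upwards [eventually_le_ofReal_of_tendsto_zero hd hε] with t ht
  intro x hxU hxt m hm
  have hmem : x ∈ Subtype.val '' B.timeSlab t :=
    ⟨⟨x, hxU⟩, (ModelBackground.mem_timeSlab).2 hxt, rfl⟩
  have h1 := enorm_iteratedFDeriv_le_supCkENorm hm hmem (𝓢.deviationExtend B Φ)
  have h2 : ENNReal.ofReal 1 * ‖iteratedFDeriv ℝ m (𝓢.deviationExtend B Φ) x‖ₑ ≤ ENNReal.ofReal ε := by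
    rw [ENNReal.ofReal_one, one_mul]
    exact h1.trans ht
  have := mul_norm_le_of_le_ofReal zero_le_one hε.le h2
  rwa [one_mul] at this

/-! ### The weight and the distance to the nearest centre -/

/-- The crux's weight is `d^{7/4}`: `√(√(d⁷)) = d ^ (7/4)` for `d ≥ 0`. [folklore] -/
theorem sqrt_sqrt_pow_seven {d : ℝ} (hd : 0 ≤ d) : √(√(d ^ 7)) = d ^ (7 / 4 : ℝ) := by
  rw [Real.sqrt_eq_rpow, Real.sqrt_eq_rpow, ← Real.rpow_natCast d 7, ← Real.rpow_mul hd,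
    ← Real.rpow_mul hd]
  norm_num

/-- The weight dominates `r^{7/4}` for `d ≥ r ≥ 0`: `r ^ (7/4) ≤ 1 + √(√(d⁷))`. [folklore] -/
theorem rpow_le_weight {r d : ℝ} (hr : 0 ≤ r) (hrd : r ≤ d) : r ^ (7 / 4 : ℝ) ≤ 1 + √(√(d ^ 7)) := by
  rw [sqrt_sqrt_pow_seven (hr.trans hrd)]
  have h1 : r ^ (7 / 4 : ℝ) ≤ d ^ (7 / 4 : ℝ) := Real.rpow_le_rpow hr hrd (by norm_num)
  have h2 : 0 ≤ (1 : ℝ) := zero_le_one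
  linarith

/-- **From a weighted bound to a decay bound**: if `(1 + √(√(d⁷))) a ≤ ε` with `a ≥ 0` and
`0 < r ≤ d`, then `a ≤ ε (r ^ (7/4))⁻¹`. [folklore] -/
theorem le_mul_rpow_inv_of_weighted {r d a ε : ℝ} (hr : 0 < r) (hrd : r ≤ d) (ha : 0 ≤ a)
    (h : (1 + √(√(d ^ 7))) * a ≤ ε) : a ≤ ε * (r ^ (7 / 4 : ℝ))⁻¹ := by
  have hw : r ^ (7 / 4 : ℝ) ≤ 1 + √(√(d ^ 7)) := rpow_le_weight hr.le hrd
  have hrp : 0 < r ^ (7 / 4 : ℝ) := Real.rpow_pos_of_pos hr _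
  rw [le_mul_inv_iff₀ hrp]
  calc a * r ^ (7 / 4 : ℝ) ≤ a * (1 + √(√(d ^ 7))) := mul_le_mul_of_nonneg_left hw ha
    _ = (1 + √(√(d ^ 7))) * a := mul_comm _ _
    _ ≤ ε := h

/-- `ρ ≤ ⨅ᵢ ‖y − ξᵢ‖` iff `ρ ≤ ‖y − ξᵢ‖` for all `i` (`Fin N`, `0 < N`). [folklore] -/
theorem le_iInf_norm_sub_iff {N : ℕ} (hN : 0 < N) {y : E3} {ξ : Fin N → E3} {ρ : ℝ} :
    ρ ≤ ⨅ i, ‖y - ξ i‖ ↔ ∀ i, ρ ≤ ‖y - ξ i‖ := by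
  haveI : Nonempty (Fin N) := ⟨⟨0, hN⟩⟩
  exact le_ciInf_iff (Finite.bddBelow_range _)

/-- `⨅ᵢ ‖y − ξᵢ‖ ≤ ‖y − ξⱼ‖`. [folklore] -/
theorem iInf_norm_sub_le {N : ℕ} {y : E3} (ξ : Fin N → E3) (j : Fin N) :
    ⨅ i, ‖y - ξ i‖ ≤ ‖y - ξ j‖ :=
  ciInf_le (Finite.bddBelow_range _) j

/-- `0 ≤ ⨅ᵢ ‖y − ξᵢ‖` (also for `N = 0`, where the infimum is `0`). [folklore] -/
theorem iInf_norm_sub_nonneg {N : ℕ} {y : E3} (ξ : Fin N → E3) : 0 ≤ ⨅ i, ‖y - ξ i‖ := by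
  rcases Nat.eq_zero_or_pos N with rfl | hN
  · simp
  · haveI : Nonempty (Fin N) := ⟨⟨0, hN⟩⟩
    exact le_ciInf fun i ↦ norm_nonneg _

/-! ### Clearance of admissible windows -/

/-- **Clearance on a window sphere**: if `‖y − c‖ = R` and the centre `ξ` is within `(1−δ)R` or beyond
`(1+δ)R` of `c`, then `δR ≤ ‖y − ξ‖` (triangle inequality). [folklore] -/
theorem clearance_of_window {c y ξ : E3} {R δ : ℝ} (hy : ‖y - c‖ = R)
    (h : ‖ξ - c‖ ≤ (1 - δ) * R ∨ (1 + δ) * R ≤ ‖ξ - c‖) : δ * R ≤ ‖y - ξ‖ := by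
  rcases h with h | h
  · have h1 : ‖y - c‖ ≤ ‖y - ξ‖ + ‖ξ - c‖ := norm_sub_le_norm_sub_add_norm_sub y ξ c
    nlinarith
  · have h1 : ‖ξ - c‖ ≤ ‖ξ - y‖ + ‖y - c‖ := norm_sub_le_norm_sub_add_norm_sub ξ y c
    rw [norm_sub_rev ξ y] at h1
    nlinarith

/-- **Clearance inside a window from the outsiders**: if `‖y − c‖ ≤ R` and `(1+δ)R ≤ ‖ξ − c‖`, then
`δR ≤ ‖y − ξ‖`. [folklore] -/
theorem clearance_of_mem_ball {c y ξ : E3} {R δ : ℝ} (hy : ‖y - c‖ ≤ R)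
    (h : (1 + δ) * R ≤ ‖ξ - c‖) : δ * R ≤ ‖y - ξ‖ := by
  have h1 : ‖ξ - c‖ ≤ ‖ξ - y‖ + ‖y - c‖ := norm_sub_le_norm_sub_add_norm_sub ξ y c
  rw [norm_sub_rev ξ y] at h1
  nlinarith

/-- **Clearance from the nearest centre on a window sphere**, in the form the weighted clauses use:
`δR ≤ ⨅ⱼ ‖y − ξⱼ‖` (`0 < N`). [folklore] -/
theorem le_iInf_of_window {N : ℕ} (hN : 0 < N) {c y : E3} {ξ : Fin N → E3} {R δ : ℝ}
    (hy : ‖y - c‖ = R) (h : ∀ j, ‖ξ j - c‖ ≤ (1 - δ) * R ∨ (1 + δ) * R ≤ ‖ξ j - c‖) :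
    δ * R ≤ ⨅ j, ‖y - ξ j‖ :=
  (le_iInf_norm_sub_iff hN).2 fun j ↦ clearance_of_window hy (h j)

/-- A window sphere of an admissible window lies in the cone `‖y‖ ≤ κ t` as soon as
`‖c‖ + R ≤ (κ + κ²)/2 · t ≤ κ t` (i.e. `κ ≤ 1`, `0 ≤ t`). [folklore] -/
theorem norm_le_of_window {c y : E3} {R κ t : ℝ} (hy : ‖y - c‖ = R)
    (hc : ‖c‖ + R ≤ (κ + κ ^ 2) / 2 * t) (hκ : κ ≤ 1) (hκ0 : 0 ≤ κ) (ht : 0 ≤ t) : ‖y‖ ≤ κ * t := by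
  have h1 : ‖y‖ ≤ ‖y - c‖ + ‖c‖ := norm_le_norm_sub_add y c
  have h2 : (κ + κ ^ 2) / 2 * t ≤ κ * t := by
    have : κ ^ 2 ≤ κ := by nlinarith
    nlinarith
  linarith


/-! ### Assembling a derivative bound from its time, spatial and deviation parts -/

/-- Splitting a vector of `E4` into its time and spatial parts: `v = v⁰ e₀ + w` with `w⁰ = 0`,
`‖w‖ ≤ ‖v‖` and `|v⁰| ≤ ‖v‖`. [folklore] -/
theorem split_time_space (v : E4) :
    (v - v 0 • E4.basisVector 0) 0 = 0 ∧ ‖v - v 0 • E4.basisVector 0‖ ≤ ‖v‖ ∧ |v 0| ≤ ‖v‖ := by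
  have hb : ∀ ν : Fin 4, E4.basisVector 0 ν = if ν = 0 then 1 else 0 := fun ν ↦ by
    simp [E4.basisVector]
  have hc : ∀ ν : Fin 4, (v - v 0 • E4.basisVector 0) ν = v ν - v 0 * E4.basisVector 0 ν := fun ν ↦ by
    simp
  have h0 : (v - v 0 • E4.basisVector 0) 0 = 0 := by rw [hc, hb, if_pos rfl]; ring
  have h1 : (v - v 0 • E4.basisVector 0) 1 = v 1 := by rw [hc, hb]; simp
  have h2 : (v - v 0 • E4.basisVector 0) 2 = v 2 := by rw [hc, hb]; simp
  have h3 : (v - v 0 • E4.basisVector 0) 3 = v 3 := by rw [hc, hb]; simp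
  have hn : ∀ u : E4, ‖u‖ ^ 2 = u 0 ^ 2 + u 1 ^ 2 + u 2 ^ 2 + u 3 ^ 2 := fun u ↦ by
    rw [EuclideanSpace.real_norm_sq_eq, Fin.sum_univ_four]
  refine ⟨h0, ?_, ?_⟩
  · refine (sq_le_sq₀ (norm_nonneg _) (norm_nonneg _)).1 ?_
    rw [hn, hn v, h0, h1, h2, h3]
    nlinarith [sq_nonneg (v 0)]
  · refine (sq_le_sq₀ (abs_nonneg _) (norm_nonneg _)).1 ?_
    rw [sq_abs, hn v]
    nlinarith [sq_nonneg (v 1), sq_nonneg (v 2), sq_nonneg (v 3)]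

/-- **Assembling the sphere bound `b`.** If `G` and `h` are differentiable at `y` with
`‖DG(y) e₀‖ ≤ B₀` (quasi-stationarity), `‖DG(y) w‖ ≤ B₁ ‖w‖` for spatial `w` (frozen decay) and
`‖Dh(y)‖ ≤ B₂` (weighted deviation clause), then `‖D(G + h)(y) v‖ ≤ (B₀ + B₁ + B₂) ‖v‖`. [folklore] -/
theorem norm_fderiv_add_apply_le {G h : E4 → E4 →L[ℝ] E4 →L[ℝ] ℝ} {y : E4}
    (hG : DifferentiableAt ℝ G y) (hh : DifferentiableAt ℝ h y) {B₀ B₁ B₂ : ℝ}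
    (h0 : ‖fderiv ℝ G y (E4.basisVector 0)‖ ≤ B₀)
    (h1 : ∀ w : E4, w 0 = 0 → ‖fderiv ℝ G y w‖ ≤ B₁ * ‖w‖) (h2 : ‖fderiv ℝ h y‖ ≤ B₂)
    (hB₁ : 0 ≤ B₁) (v : E4) :
    ‖fderiv ℝ (fun x ↦ G x + h x) y v‖ ≤ (B₀ + B₁ + B₂) * ‖v‖ := by
  obtain ⟨hw0, hwn, hv0⟩ := split_time_space v
  set w : E4 := v - v 0 • E4.basisVector 0 with hw
  have hv : v = v 0 • E4.basisVector 0 + w := by rw [hw]; abel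
  have hB₂ : 0 ≤ B₂ := (norm_nonneg _).trans h2
  rw [fderiv_fun_add hG hh, add_apply]
  refine (norm_add_le _ _).trans ?_
  have hGv : ‖fderiv ℝ G y v‖ ≤ (B₀ + B₁) * ‖v‖ := by
    conv_lhs => rw [hv]
    rw [map_add, map_smul]
    refine (norm_add_le _ _).trans ?_
    rw [norm_smul, Real.norm_eq_abs]
    calc |v 0| * ‖fderiv ℝ G y (E4.basisVector 0)‖ + ‖fderiv ℝ G y w‖
        ≤ ‖v‖ * B₀ + B₁ * ‖w‖ := add_le_add (mul_le_mul hv0 h0 (norm_nonneg _) (norm_nonneg _)) (h1 w hw0)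
      _ ≤ ‖v‖ * B₀ + B₁ * ‖v‖ := by gcongr
      _ = (B₀ + B₁) * ‖v‖ := by ring
  have hhv : ‖fderiv ℝ h y v‖ ≤ B₂ * ‖v‖ :=
    ((fderiv ℝ h y).le_opNorm v).trans (mul_le_mul_of_nonneg_right h2 (norm_nonneg _))
  calc ‖fderiv ℝ G y v‖ + ‖fderiv ℝ h y v‖ ≤ (B₀ + B₁) * ‖v‖ + B₂ * ‖v‖ := add_le_add hGv hhv
    _ = (B₀ + B₁ + B₂) * ‖v‖ := by ring

/-! ### The Landau–Lifshitz complex with a time index is a SPATIAL divergence -/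

/-- **`emComplex^{μ0} = Σ_j ∂_j h^{μ0j}`**: the `α = 0` term of `Σ_α ∂_α h^{μ0α}` drops out because
`h^{μ00} = 0` identically (`hField_self`, LL (96.4)); this is why the quasi-local momentum of a ball
is a pure surface term (LL, derivation of (96.16)). [cite: LandauLifshitz1975, §96 (96.16)] -/
theorem emComplex_time_eq_sum_spatial (g : E4 → E4 →L[ℝ] E4 →L[ℝ] ℝ) (x : E4) (μ : Fin 4) :
    LandauLifshitz.emComplex g x μ 0 =
      ∑ j : Fin 3, LandauLifshitz.partialDeriv j.succ (fun y ↦ LandauLifshitz.hField g y μ 0 j.succ) x := by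
  rw [LandauLifshitz.emComplex, Fin.sum_univ_succ]
  have h0 : (fun y ↦ LandauLifshitz.hField g y μ 0 0) = fun _ ↦ (0 : ℝ) :=
    funext fun y ↦ LandauLifshitz.hField_self g y μ 0
  rw [h0, LandauLifshitz.partialDeriv, fderiv_const_apply]
  simp

end WindowBounds

/-- Registered sub-goal form (stub `weightedClause_pointwise_bound` of the crux item) of
`WindowBounds.weightedClause_pointwise`: the crux's weighted `C³` decay clause read pointwise on the
lab slabs. [folklore] -/
theorem weightedClause_pointwise_bound : open Literature.Geometry.Lorentzian Filter in ∀ {N : ℕ} {U : TopologicalSpace.Opens E4} {κ : ℝ} {ξ : Fin N → ℝ → E3} {h : E4 → E4 →L[ℝ] E4 →L[ℝ] ℝ}, Tendsto (fun t : ℝ ↦ ⨆ x ∈ {x : U | x.1 0 = t ∧ E4.spatialNorm x.1 ≤ κ * t}, ⨆ (m : ℕ) (_ : m ≤ 3), ENNReal.ofReal (1 + √(√((⨅ i, ‖E4.spatial x.1 - ξ i t‖) ^ 7))) * ‖iteratedFDeriv ℝ m h x.1‖ₑ) atTop (nhds 0) → ∀ {ε : ℝ}, 0 < ε → ∀ᶠ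 t in atTop, ∀ x : E4, x ∈ (U : Set E4) → x 0 = t → E4.spatialNorm x ≤ κ * t → ∀ m : ℕ, m ≤ 3 → (1 + √(√((⨅ i, ‖E4.spatial x - ξ i t‖) ^ 7))) * ‖iteratedFDeriv ℝ m h x‖ ≤ ε :=
  fun hW _ hε ↦ WindowBounds.weightedClause_pointwise hW hε

end Summit.FinalStateConjecture.FinalStateConjecture.Theorems

end
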